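import HarnessLib
import Summits.Ventures.WeilGRH.OneCompletePrimesFrom31
import Summits.Ventures.WeilGRH.OneCompleteMod17All
import Summits.Ventures.WeilGRH.OneCompleteMod19All
import Summits.Ventures.WeilGRH.OneCompleteMod23All
import Summits.Ventures.WeilGRH.OneCompleteMod29All

/-!
# GRH arm (rh-explicit, venture WeilGRH): Weil positivity on `[−1, 1]` for EVERY non-principal Dirichlet character of EVERY prime modulus `p ≥ 17`

Cell `rh-explicit`, WEIL TRACK — GRH ARM (seat weil-grh-1 gen12).  Pure assembly extending `OneCompletePrimesFrom31` (`p ≥ 31`) by the four prime levels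
`17, 19, 23, 29`, each now decided in full (`OneCompleteMod17All` / `19All` / `23All` / `29All`: even classes by weil-grh-2's door-C χ-cells and real islands,
odd classes by weil-grh-3's format-D-K lattice certificates).  With `UniformFloor.not_weilPositivityOnChar_one_principal_of_prime_le` (the principal character
of every prime `p ≤ 73` FAILS on `[−1, 1]`) and `UniformFloor.forall_weilPositivityOnChar_one_iff_of_prime` (`p ≥ 79`: every character is positive) the
`t = 1` picture for prime moduli `p ≥ 17` is complete: EXACTLY the principal character fails when `p ≤ 73`, nothing fails from `79` on.
(Primes `p ≤ 13` are not claimed here: 13 waits for its even complex classes, 2–11 for small-conductor certificates.)  Pure assembly; RH/GRH-free; standard axioms.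
-/

noncomputable section

namespace Summit.Ventures.WeilGRH.OneCompletePrimesFrom17
open Literature.NumberTheory.LFunctions

/-- ★★★ **Every non-principal Dirichlet character of every PRIME modulus `p ≥ 17` satisfies Weil positivity on `[−1, 1]`**
(`WeilPositivityOnChar χ 1`).  For `17 ≤ p ≤ 73` the principal character fails, so `χ ≠ 1` is sharp there.
[cite: Weil1952FormulesExplicites, (11) pp. 261–262 and the «lemme» p. 262] -/
theorem weilPositivityOnChar_one_of_prime_ge_17 {p : ℕ} (hp : p.Prime) (h17 : 17 ≤ p)
    (χ : DirichletCharacter ℂ p) (hχ : χ ≠ 1) : WeilPositivityOnChar χ 1 := by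
  by_cases h31 : 31 ≤ p
  · exact OneCompletePrimesFrom31.weilPositivityOnChar_one_of_prime_ge_31 hp h31 χ hχ
  · have h30 : p ≤ 30 := by omega
    have key : p = 17 ∨ p = 19 ∨ p = 23 ∨ p = 29 := by
      interval_cases p <;> first | decide | norm_num at hp
    rcases key with rfl | rfl | rfl | rfl
    · exact OneCompleteMod17All.weilPositivityOnChar_mod17_one χ hχ
    · exact OneCompleteMod19All.weilPositivityOnChar_mod19_one χ hχ
    · exact OneCompleteMod23All.weilPositivityOnChar_mod23_one χ hχ
    · exact OneCompleteMod29All.weilPositivityOnChar_mod29_one χ hχ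

/-- ★★★ **PRIME MODULI `p ≥ 17`: every non-principal character is Weil-positive on every window `[−t, t]`, `t ≤ 1`.** [folklore] -/
theorem weilPositivityOnChar_of_le_one_of_prime_ge_17 {p : ℕ} (hp : p.Prime) (h17 : 17 ≤ p)
    (χ : DirichletCharacter ℂ p) (hχ : χ ≠ 1) {t : ℝ} (ht : t ≤ 1) : WeilPositivityOnChar χ t := fun g hg hsupp ↦
  weilPositivityOnChar_one_of_prime_ge_17 hp h17 χ hχ g hg (hsupp.trans (Set.Icc_subset_Icc (by linarith) ht))

/-- ★★★ **PRIME MODULI `17 ≤ p ≤ 73`: EXACTLY the principal character fails Weil positivity on `[−1, 1]`** —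
`WeilPositivityOnChar χ 1 ↔ χ ≠ 1` for every Dirichlet character `χ` mod `p`.
[cite: Weil1952FormulesExplicites, (11) pp. 261–262 and the «lemme» p. 262] -/
theorem weilPositivityOnChar_one_iff_ne_one_of_prime_ge_17 {p : ℕ} (hp : p.Prime) (h17 : 17 ≤ p) (h73 : p ≤ 73)
    (χ : DirichletCharacter ℂ p) : WeilPositivityOnChar χ 1 ↔ χ ≠ 1 :=
  ⟨fun h h1 ↦ UniformFloor.not_weilPositivityOnChar_one_principal_of_prime_le hp h73 (h1 ▸ h),
   weilPositivityOnChar_one_of_prime_ge_17 hp h17 χ⟩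

/-- ★★★ **The failing set at a prime level `17 ≤ p ≤ 73` is the singleton `{1}`; at a prime level `p ≥ 79` it is empty.** [folklore] -/
theorem not_weilPositivityOnChar_one_iff_of_prime_ge_17 {p : ℕ} (hp : p.Prime) (h17 : 17 ≤ p) (χ : DirichletCharacter ℂ p) :
    ¬ WeilPositivityOnChar χ 1 ↔ (χ = 1 ∧ p ≤ 73) := by
  constructor
  · intro h
    by_cases h73 : p ≤ 73
    · exact ⟨not_ne_iff.mp fun h1 ↦ h (weilPositivityOnChar_one_of_prime_ge_17 hp h17 χ h1), h73⟩
    · have h78 : 78 ≤ p := by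
        by_contra h78
        have h4 : p = 74 ∨ p = 75 ∨ p = 76 ∨ p = 77 := by omega
        rcases h4 with rfl | rfl | rfl | rfl <;> norm_num at hp
      exact absurd (UniformFloor.weilPositivityOnChar_one_of_ge_78 h78 χ) h
  · rintro ⟨rfl, h73⟩
    exact UniformFloor.not_weilPositivityOnChar_one_principal_of_prime_le hp h73

end Summit.Ventures.WeilGRH.OneCompletePrimesFrom17

end
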